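import Summits.QuantumFields.YangMills.Theorems.SwapVirialDeficitRingTraceSmooth
import Summits.QuantumFields.YangMills.Theorems.VirialFluxGapLogSectorWeightConvex
import HarnessLib

/-!
# Route `SwapVirialDeficit` (YangMills): LOG-CONVEXITY of the swap-glued ring trace `b ↦ log Z^S(L,b,T)` in the coupling

Stub `stub_logTwistTraceConvex : LogTwistTraceConvex` of the BC3 skeleton LINE «sharp-sigma» for the crux
`SwapVirialDeficit.SwapGluedStiffness` (item stmt-QuantumFields-24197; planner ym-idea-4 g14, HOME
bc/g14-B/sigma/SwapGluedStiffness_sharp_birth.lean, critic PASS): for every spatial torus `(ℤ/L)³` and every `T`,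
`b ↦ log (TT.twistTrace L b T)` is convex on `ℝ`.  The statement below (`logTwistTraceConvex`) is the stub's Prop
`∀ (L : ℕ) [NeZero L] (T : ℕ), ConvexOn ℝ Set.univ (fun b : ℝ => Real.log (TT.twistTrace L b T))` verbatim, so the skeleton's
stub closes by `exact logTwistTraceConvex`.

Mechanism: by the landed seam-outermost form ✓`TT.SectorSmooth.twistTraceSucc_eq_sum_integral_prod` and
✓`swapSeamChain_eq_exp` (w3 g35, p703507), `Z^S(b) = (1/8) Σ_z ∫ exp(b·Ψ^S_z) dν` with `Ψ^S_z` bounded measurable on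
`ν = slices ⊗ seam field`.  Reading the finite `z`-sum as an integral against the counting measure on `(ℤ/2)³`,
`Z^S(b) = (1/8)·mgf Ψ^S (ν ⊗ count) (b)` is one exponential tilt of a bounded variable on a finite measure, so
`log Z^S = log(1/8) + cgf Ψ^S (ν ⊗ count)` is convex by ✓`convexOn_cgf_of_bounded` (my p706916).

HONEST FRAMING: an S stub of an evidence skeleton (DRAFT-by-design line); the heart `SharpSwapLaplace` and the crux
`SwapGluedStiffness` (24197) are OPEN; no rung / summit statement is proved; the Yang–Mills mass gap is NOT proved.  THEOREMS ONLY
(0 `def`, 0 `sorry`), standard axioms.  References: [cite: tHooft1979]; [cite: MontvayMunster1994, (3.145)]; [cite: Griffiths1964].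
-/

set_option autoImplicit false

noncomputable section

open MeasureTheory Filter Set Function ProbabilityTheory
open scoped BigOperators Topology
open Literature.MathematicalPhysics.QuantumFieldTheory hiding SU2

namespace Summit.QuantumFields.YangMills.Theorems.FemtoTransferGap.TT.SectorSmooth

open Summit.QuantumFields.YangMills.Theorems.FemtoTransferGap
open Summit.QuantumFields.YangMills.Theorems.FemtoTransferGap.TT

/-! ## §1 A finite sum of exponential tilts is one exponential tilt against `ν ⊗ count` -/

section SumTilt

variable {Ω : Type*} [MeasurableSpace Ω] (ν : Measure Ω) [SFinite ν] [IsFiniteMeasure ν]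
  {ι : Type*} [Fintype ι] [MeasurableSpace ι] [MeasurableSingletonClass ι]
  {Ψ : Ω × ι → ℝ} {B : ℝ}

/-- `Σ_z ∫ e^{bΨ(·,z)} dν = ∫ e^{bΨ} d(ν ⊗ count)` for bounded measurable `Ψ` on `Ω × ι`, `ι` finite. [folklore] -/
theorem sum_integral_exp_mul_eq_integral_prod_count (hΨ : Measurable Ψ) (hB : ∀ q, |Ψ q| ≤ B) (b : ℝ) :
    ∑ z : ι, ∫ p, Real.exp (b * Ψ (p, z)) ∂ν = ∫ q, Real.exp (b * Ψ q) ∂(ν.prod Measure.count) := by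
  have hmeas : Measurable fun q : Ω × ι => Real.exp (b * Ψ q) := (measurable_const.mul hΨ).exp
  have hint : Integrable (fun q : Ω × ι => Real.exp (b * Ψ q)) (ν.prod Measure.count) := by
    refine Integrable.of_bound hmeas.aestronglyMeasurable (Real.exp (|b| * B)) (ae_of_all _ fun q => ?_)
    rw [Real.norm_eq_abs, Real.abs_exp]
    refine Real.exp_le_exp.2 ?_
    have h1 : |b * Ψ q| ≤ |b| * B := by
      rw [abs_mul]; exact mul_le_mul_of_nonneg_left (hB q) (abs_nonneg _)
    exact (le_abs_self _).trans h1
  rw [integral_prod _ hint]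
  have hinner : ∀ p : Ω, ∫ z : ι, Real.exp (b * Ψ (p, z)) ∂Measure.count = ∑ z : ι, Real.exp (b * Ψ (p, z)) :=
    fun p => integral_count _
  simp_rw [hinner]
  rw [integral_finsetSum]
  intro z _
  refine Integrable.of_bound ((measurable_const.mul (hΨ.comp (measurable_id.prodMk measurable_const))).exp).aestronglyMeasurable
    (Real.exp (|b| * B)) (ae_of_all _ fun p => ?_)
  rw [Real.norm_eq_abs, Real.abs_exp]
  refine Real.exp_le_exp.2 ?_
  have h1 : |b * Ψ (p, z)| ≤ |b| * B := by
    rw [abs_mul]; exact mul_le_mul_of_nonneg_left (hB (p, z)) (abs_nonneg _)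
  exact (le_abs_self _).trans h1

/-- ★ `b ↦ log (c · Σ_z ∫ e^{bΨ(·,z)} dν)` is convex on `ℝ` for `c > 0`, bounded measurable `Ψ`, finite `ν`, finite `ι`:
it is `log c + cgf Ψ (ν ⊗ count)`. [cite: Griffiths1964] -/
theorem convexOn_log_const_mul_sum_integral_exp_mul (hΨ : Measurable Ψ) (hB : ∀ q, |Ψ q| ≤ B) {c : ℝ} (hc : 0 < c)
    (hpos : ∀ b : ℝ, 0 < ∑ z : ι, ∫ p, Real.exp (b * Ψ (p, z)) ∂ν) :
    ConvexOn ℝ univ (fun b : ℝ => Real.log (c * ∑ z : ι, ∫ p, Real.exp (b * Ψ (p, z)) ∂ν)) := by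
  have hcgf := convexOn_cgf_of_bounded (ν.prod Measure.count) hΨ hB
  have hfun : (fun b : ℝ => Real.log (c * ∑ z : ι, ∫ p, Real.exp (b * Ψ (p, z)) ∂ν)) =
      fun b : ℝ => Real.log c + cgf Ψ (ν.prod Measure.count) b := by
    funext b
    rw [Real.log_mul hc.ne' (hpos b).ne', sum_integral_exp_mul_eq_integral_prod_count ν hΨ hB b]
    simp only [cgf, mgf]
  rw [hfun]
  exact (convexOn_const (Real.log c) convex_univ).add hcgf

end SumTilt

/-! ## §2 The swap-glued ring trace -/

section Swap

variable {L : ℕ} [NeZero L]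

/-- ★★ **`b ↦ log Z^S(L,b,n+1)` is convex on `ℝ`.** [cite: tHooft1979] [cite: MontvayMunster1994, (3.145)] -/
theorem convexOn_log_twistTraceSucc (n : ℕ) :
    ConvexOn ℝ univ (fun b : ℝ => Real.log (twistTraceSucc L b n)) := by
  haveI := isProbabilityMeasure_gaugeMeasure (L := L)
  -- the swap-seamed exponent, jointly in (history × seam field, z)
  set Ψ : ((Fin (n + 1) → GaugeConfig 3 L SU2) × (Site 3 L → SU2)) × (Fin 3 → Bool) → ℝ := fun q =>
    Real.log ((∏ i : Fin n, transferKernel su2Rep 1 (q.1.1 i.castSucc) (q.1.1 i.succ)) *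
      transferKernel su2Rep 1 (q.1.1 (Fin.last n))
        (gaugeTransform q.1.2 (twist3 q.2 (configPerm (Equiv.swap (0 : Fin 3) 1) (q.1.1 0))))) with hΨ
  have hΨmeas : Measurable Ψ :=
    measurable_from_prod_countable_left fun z => (measurable_swapSeamChain (L := L) 1 n z).log
  -- a uniform bound over the finitely many `z`
  have hbound : ∃ B : ℝ, ∀ q, |Ψ q| ≤ B := by
    choose Bz hBz using fun z : Fin 3 → Bool => exists_abs_log_swapSeamChain_one_le (L := L) n z
    refine ⟨Finset.univ.sup' Finset.univ_nonempty Bz, fun q => ?_⟩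
    exact (hBz q.2 q.1).trans (Finset.le_sup' Bz (Finset.mem_univ q.2))
  obtain ⟨B, hB⟩ := hbound
  have hpos : ∀ b : ℝ, 0 < ∑ z : Fin 3 → Bool,
      ∫ p, Real.exp (b * Ψ (p, z)) ∂((Measure.pi fun _ : Fin (n + 1) => configMeasure SU2 L).prod (gaugeMeasure L)) := by
    intro b
    refine Finset.sum_pos (fun z _ => ?_) Finset.univ_nonempty
    exact integral_exp_mul_pos _ (hΨmeas.comp (measurable_id.prodMk measurable_const)) (fun p => hB (p, z)) b
  have h := convexOn_log_const_mul_sum_integral_exp_mul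
    ((Measure.pi fun _ : Fin (n + 1) => configMeasure SU2 L).prod (gaugeMeasure L)) hΨmeas hB
    (by norm_num : (0 : ℝ) < 1 / 8) hpos
  have hfun : (fun b : ℝ => Real.log (twistTraceSucc L b n)) = fun b : ℝ => Real.log ((1 / 8 : ℝ) * ∑ z : Fin 3 → Bool,
      ∫ p, Real.exp (b * Ψ (p, z)) ∂((Measure.pi fun _ : Fin (n + 1) => configMeasure SU2 L).prod (gaugeMeasure L))) := by
    funext b
    rw [twistTraceSucc_eq_sum_integral_prod b n]
    congr 2
    refine Finset.sum_congr rfl fun z _ => integral_congr_ae (ae_of_all _ fun p => ?_)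
    exact swapSeamChain_eq_exp b n z p
  rw [hfun]
  exact h

/-- ★★ **`LogTwistTraceConvex`** (the Prop of stub `stub_logTwistTraceConvex` of LINE «sharp-sigma» on crux stmt-QuantumFields-24197,
verbatim): for every `L`, `T`, `b ↦ log (TT.twistTrace L b T)` is convex on `ℝ`.  No crux / rung / summit is proved; the YM mass
gap is NOT proved. [cite: tHooft1979] [cite: Griffiths1964] -/
theorem logTwistTraceConvex :
    ∀ (L : ℕ) [NeZero L] (T : ℕ), ConvexOn ℝ Set.univ (fun b : ℝ => Real.log (TT.twistTrace L b T)) := by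
  intro L _ T
  unfold twistTrace
  exact convexOn_log_twistTraceSucc (L := L) (T - 1)

end Swap

end Summit.QuantumFields.YangMills.Theorems.FemtoTransferGap.TT.SectorSmooth

end
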